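/- Copyright: the b2b-balaban cell (near-miss cell 7), T⁴-continuum fan-out, lineage t4-ne7b-p1 (node U5c COUNT
member).  Released under the licence of the surrounding project. -/
import Literature.MathematicalPhysics.QuantumFieldTheory.Balaban1983to89.T4PrintedShapeBanking

/-!
# Admissible histories (H1a): the combinatorial skeleton of print's inductive description, and WHICH of them the
landed (ID) carrier can label (swarm row S1 of `t4/b2b-balaban-t4-ne7b-p1/LEAVES-NE7b.md`)

Summits-side support leaf of the T⁴-continuum cell (rung (B)+1 on a FINITE torus only; NOT infinite volume, NOT the
mass gap, NOT the Clay statement; NOT a proof of the spine estimate NE7b).  Lineage `t4-ne7b-p1` (generation 22, row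
NE7b owner), node U5c.  [folklore] finite combinatorics over the lineage's OWN carrier
(`T4PersistenceDictionary.Gen`∕`PEv`, `T4PrintedShapeBanking.Consistent`); nothing printed is asserted.  B16 =
[Balaban1989LargeFieldII] pp. 383–387 is quoted for what it STATES (certified reading C-B16-6, page table
`t4/T4-XREAD-NE7b-READING.md` V1–V6∕D1–D7): the identification (H3) «these trees ARE the histories of the terms of
Bałaban's density» stays a DISPLAYED hypothesis of the assembly and is NOT minted here (trigger condition c1).

WHAT IS TYPED (§1).  `PGen γ` = the COMBINATORIAL SKELETON of a pending component's history as print describes it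
inductively: a component is BORN as a new large-field region at some step `j` with a class `d′` («d′_j is the
linear size defined in terms of MR_j-cubes», p. 380; the `d′_j(Z)` of the factor on p. 381) at a root cell (`birth`); a READY component acquiring a new large
field in the preparatory operations of the next step is RENEWED (p. 385 bottom – p. 386 l. 3: «Z = S(Z₀), Z₀ satisfies
the conditions (i), (ii), and a new large field was introduced in the preparatory operations … hence K = R_{j+1} for
Z») (`renew G h`, ready at `h`, renewed at `h + 1`); in the second case (p. 386 ll. 3–6: «Z is obtained from some
number of components of Z_j, and some number of new large field regions, joined together into the one component of
Z_{j+1} by the operations of the last step») the constituents are joined, and print itself binarises the join along «a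
maximal tree graph contained in the graph G» with endpoint `X` and rest `Y` (p. 386) — `join X Y s`, any number of
binary joins at one step.  Steps are PHYSICAL steps.  What is NOT here (H1b, separate leaf): the geometric realisation
(regions as cube families on the torus, the operation `S`, readiness by (i)∕(ii) with `N = R_j`), which DERIVES the
timing discipline `Adm` (§3) and bounds physical lives by the booked reaches.

WHAT IS PROVED.  §2 the canonical labelling `toGen : PGen γ → Gen PEv` into the landed carrier (birth ↦ `(j,0,d′)`,
renewal ↦ `(h+1,1,0)`, join ↦ `(s,2,0)`; root step and root cell), its event multiset `evTypes`, and the LOCATED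
OBSTRUCTION of finding F-ne7bp1g22-1(d): the carrier's events are a SET of type triples, so
**`distinct_toGen_iff : DistinctEv (toGen P) ↔ TypeNodup P`** and **`not_wf_toGen`**: a history with a repeated
event type — e.g. two regions of the same class born at the same step and joined later, `twin` (§6, decided) — has NO
well-formed canonical label for ANY window table.  §3 print's timing discipline `Adm K` (physical), §4 the two
MODEL-TIME side conditions the landed `Consistent`∕`WF` impose beyond it — `RenewAtReach W` (renewal exactly at the
BOOKED reach, finding F-ne7bp1g22-1(c)) and `JoinInLife W` — and the positive half: **`consistent_toGen`**,
**`wf_toGen`**: `Adm ∧ RenewAtReach ∧ JoinInLife (∧ TypeNodup)` ⇒ the canonical label is `Consistent` and `WF` —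
the sub-class on which rows S3–S7 of the swarm table can be certified over the landed carrier (owner's ruling R-A,
LEAVES v1.5).  §5 class-MONOTONICITY of the booked window and of the birth credit (larger class ⇒ LONGER window AND
LARGER credit).  (DOCFIX, XREAD leaf-04 R1: the grouping convention H-GROUP — several new regions of classes `dᵢ`
entering one component at one step ↦ ONE birth of class `D` — is credit-conservative only against the SUM
`Σᵢ credit(dᵢ)`, i.e. when `D + 1 ≤ Σᵢ (dᵢ + 1)`, e.g. `D := Σ dᵢ + (k − 1)`; it is WITHDRAWN as a convention by ruling
R-OWNER-22-1 R3 — every new region keeps its own tagged birth.)  §6 decided sanity.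

HONEST.  Re-scopes S1 to the skeleton + the carrier census; proves nothing of Bałaban's; the complement of
`TypeNodup ∧ RenewAtReach` is the COUNT route's carrier debt (multiset records; renewal clause `≤`), GAPS
F-ne7bp1g22-1.  NE7b NOT proved.  HONEST DEPENDENCY (cell): continuum YM on T⁴ ⇐ BetaPertH ∧ nine spine estimates
(0/9 proved); BetaPertH ⇐ (D1) ∧ (D4) ∧ CAP+tail.  This file changes none of it.
-/

open Finset
open Literature.MathematicalPhysics.QuantumFieldTheory.Balaban1983to89
open T4PersistenceDictionary T4PrintedShapeBanking

namespace Summit.QuantumFields.BalabanUV.T4Continuum.HistoryAdmissible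

/-! ## §1 The combinatorial skeleton of a pending component's history -/

/-- **THE PHYSICAL GENEALOGY OF A PENDING COMPONENT** (print's inductive description, B16 pp. 383–387, as DATA; steps
are physical): `birth j d z` — a new large-field region of class `d` born at step `j` with root cell `z`; `renew G h` —
the component `G`, READY at step `h`, acquires a new large field in the preparatory operations of step `h + 1`;
`join X Y s` — the binary step of print's maximal-tree decomposition of a join at step `s` (endpoint `X`, rest `Y`;
an m1 join has a `birth s d z` partner, an m2 join two composite partners). [folklore] -/
inductive PGen (γ : Type*) : Type _
  | birth (j : ℕ) (cls : ℕ) (cell : γ) : PGen γ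
  | renew (G : PGen γ) (h : ℕ) : PGen γ
  | join (X Y : PGen γ) (s : ℕ) : PGen γ
  deriving DecidableEq

namespace PGen

variable {γ : Type*}

/-- the ROOT STEP `j(Z)`: «the index of a first large field region contained in Z» (p. 384) [folklore] -/
def rootStep : PGen γ → ℕ
  | birth j _ _ => j
  | renew G _ => G.rootStep
  | join X Y _ => min X.rootStep Y.rootStep

/-- the ROOT CELL: the cell of the first-born constituent (ties towards the endpoint `X`, as `Gen.root`) [folklore] -/
def rootCell : PGen γ → γ
  | birth _ _ z => z
  | renew G _ => G.rootCell
  | join X Y _ => if X.rootStep ≤ Y.rootStep then X.rootCell else Y.rootCell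

/-- the LAST STEP at which the history has an event [folklore] -/
def lastStep : PGen γ → ℕ
  | birth j _ _ => j
  | renew _ h => h + 1
  | join _ _ s => s

/-- the number of constituent regions [folklore] -/
def regions : PGen γ → ℕ
  | birth _ _ _ => 1
  | renew G _ => G.regions
  | join X Y _ => X.regions + Y.regions

/-! ## §2 The canonical labelling into the landed carrier, and the located obstruction -/

/-- **THE EVENT TYPES** of the history, as a MULTISET of the carrier's triples `(step, kind, class)`: births
`(j, 0, d′)`, renewals `(h+1, 1, 0)`, joins `(s, 2, 0)`. [folklore] -/
def evTypes : PGen γ → Multiset PEv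
  | birth j d _ => {((j, 0, d) : PEv)}
  | renew G h => ((h + 1, 1, 0) : PEv) ::ₘ G.evTypes
  | join X Y s => ((s, 2, 0) : PEv) ::ₘ (X.evTypes + Y.evTypes)

/-- **`TypeNodup`**: no event type occurs twice in the history (decidable). [folklore] -/
def TypeNodup (P : PGen γ) : Prop := P.evTypes.Nodup

/-- `TypeNodup` is decidable [folklore] -/
instance (P : PGen γ) : Decidable P.TypeNodup := inferInstanceAs (Decidable P.evTypes.Nodup)

/-- **THE CANONICAL LABEL** in the landed carrier `Gen PEv` (the carrier's three constructors are print's three cases;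
labels = the dictionary's event types, `T4PersistenceDictionary` §3). [folklore] -/
def toGen : PGen γ → Gen PEv
  | birth j d _ => Gen.born (j, 0, d) j
  | renew G h => Gen.renew G.toGen (h + 1, 1, 0) h
  | join X Y s => Gen.merge X.toGen Y.toGen (s, 2, 0)

/-- the label keeps the root step [folklore] -/
@[simp] theorem rootStep_toGen : ∀ P : PGen γ, P.toGen.rootStep = P.rootStep
  | birth j d z => rfl
  | renew G h => by simp [toGen, rootStep, rootStep_toGen G]
  | join X Y s => by simp [toGen, rootStep, rootStep_toGen X, rootStep_toGen Y]

/-- the label's event SET is the support of the event multiset [folklore] -/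
theorem events_toGen : ∀ P : PGen γ, P.toGen.events = P.evTypes.toFinset
  | birth j d z => by simp [toGen, evTypes]
  | renew G h => by simp [toGen, evTypes, events_toGen G]
  | join X Y s => by simp [toGen, evTypes, events_toGen X, events_toGen Y, Multiset.toFinset_add]

/-- THE DISTINCTNESS CLAUSES of `Gen.WF`, separated from its timing clauses. [folklore] -/
def DistinctEv : Gen PEv → Prop
  | Gen.born _ _ => True
  | Gen.renew G e _ => DistinctEv G ∧ e ∉ G.events
  | Gen.merge X Y e => DistinctEv X ∧ DistinctEv Y ∧ e ∉ X.events ∧ e ∉ Y.events ∧ Disjoint X.events Y.events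

/-- well-formedness contains the distinctness clauses [folklore] -/
theorem distinctEv_of_wf (W : PEv → ℕ) : ∀ G : Gen PEv, G.WF W → DistinctEv G
  | Gen.born _ _, _ => trivial
  | Gen.renew G e h, hW => by
      simp only [Gen.WF] at hW
      exact ⟨distinctEv_of_wf W G hW.1, hW.2.1⟩
  | Gen.merge X Y e, hW => by
      simp only [Gen.WF] at hW
      exact ⟨distinctEv_of_wf W X hW.1, distinctEv_of_wf W Y hW.2.1, hW.2.2.1, hW.2.2.2.1, hW.2.2.2.2.1⟩

/-- **THE CANONICAL LABEL IS EVENT-DISTINCT IFF THE HISTORY HAS NO REPEATED EVENT TYPE.** [folklore] -/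
theorem distinct_toGen_iff : ∀ P : PGen γ, DistinctEv P.toGen ↔ P.TypeNodup
  | birth j d z => by simp [toGen, DistinctEv, TypeNodup, evTypes]
  | renew G h => by
      have ih := distinct_toGen_iff G
      simp only [toGen, DistinctEv, TypeNodup, evTypes, Multiset.nodup_cons, events_toGen, Multiset.mem_toFinset]
      unfold TypeNodup at ih
      constructor
      · rintro ⟨h1, h2⟩; exact ⟨h2, ih.1 h1⟩
      · rintro ⟨h1, h2⟩; exact ⟨ih.2 h2, h1⟩
  | join X Y s => by
      have ihX := distinct_toGen_iff X
      have ihY := distinct_toGen_iff Y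
      unfold TypeNodup at ihX ihY
      simp only [toGen, DistinctEv, TypeNodup, evTypes, Multiset.nodup_cons, Multiset.mem_add, events_toGen,
        Multiset.mem_toFinset, not_or, Multiset.nodup_add, ihX, ihY]
      constructor
      · rintro ⟨hX, hY, h1, h2, hd⟩
        refine ⟨⟨h1, h2⟩, hX, hY, ?_⟩
        rw [Multiset.disjoint_iff_ne]
        intro a ha b hb hab
        subst hab
        exact Finset.disjoint_left.1 hd (Multiset.mem_toFinset.2 ha) (Multiset.mem_toFinset.2 hb)
      · rintro ⟨⟨h1, h2⟩, hX, hY, hd⟩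
        refine ⟨hX, hY, h1, h2, ?_⟩
        rw [Finset.disjoint_left]
        intro a ha hb
        exact Multiset.disjoint_iff_ne.1 hd a (Multiset.mem_toFinset.1 ha) a (Multiset.mem_toFinset.1 hb) rfl

/-- **THE LOCATED OBSTRUCTION (F-ne7bp1g22-1(d))**: a history with a repeated event type has NO well-formed canonical
label, for ANY window table. [folklore] -/
theorem not_wf_toGen {P : PGen γ} (h : ¬ P.TypeNodup) (W : PEv → ℕ) : ¬ P.toGen.WF W :=
  fun hW => h ((distinct_toGen_iff P).1 (distinctEv_of_wf W _ hW))

/-! ## §3 Print's timing discipline (physical) -/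

/-- **`Adm K`** — the timing discipline of print's induction up to the cutoff `K` (physical steps): a birth is observed
(`j ≤ K`); a renewal at `h + 1 ≤ K` happens to a component READY at `h`, hence after all its events (`lastStep ≤ h`);
a join at `s ≤ K` happens after every event of both partners (a partner may be a region born AT `s`: m1).  The
geometric layer H1b derives it; here it is the predicate. [folklore] -/
def Adm (K : ℕ) : PGen γ → Prop
  | birth j _ _ => j ≤ K
  | renew G h => G.Adm K ∧ G.lastStep ≤ h ∧ h + 1 ≤ K
  | join X Y s => X.Adm K ∧ Y.Adm K ∧ X.lastStep ≤ s ∧ Y.lastStep ≤ s ∧ s ≤ K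

/-- under `Adm` the root step is at most the last step [folklore] -/
theorem Adm.rootStep_le_lastStep {K : ℕ} : ∀ {P : PGen γ}, P.Adm K → P.rootStep ≤ P.lastStep
  | birth j _ _, _ => le_rfl
  | renew G h, hA => by
      have := Adm.rootStep_le_lastStep hA.1; have := hA.2.1
      simp only [rootStep, lastStep]; omega
  | join X Y s, hA => by
      have := Adm.rootStep_le_lastStep hA.1; have := hA.2.2.1
      simp only [rootStep, lastStep]; omega

/-- under `Adm` every event is observed by the cutoff [folklore] -/
theorem Adm.lastStep_le {K : ℕ} : ∀ {P : PGen γ}, P.Adm K → P.lastStep ≤ K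
  | birth _ _ _, h => h
  | renew _ _, h => h.2.2
  | join _ _ _, h => h.2.2.2.2

/-! ## §4 The model-time side conditions of the landed `Consistent` ∕ `WF`, and the positive half -/

/-- **`RenewAtReach W`** — the landed `Consistent`'s renewal clause read on the history: every renewal happens exactly
at the BOOKED reach of its line for the window table `W` (finding F-ne7bp1g22-1(c): print renews at physical readiness,
which may precede the booked bound). [folklore] -/
def RenewAtReach (W : PEv → ℕ) : PGen γ → Prop
  | birth _ _ _ => True
  | renew G h => G.RenewAtReach W ∧ h + 1 = G.toGen.reach W
  | join X Y _ => X.RenewAtReach W ∧ Y.RenewAtReach W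

/-- **`JoinInLife W`** — every join happens inside both partners' BOOKED lives `[rootStep, reach)` (physically a join
happens while both are pending; booked reach ≥ physical life is what the window table is for). [folklore] -/
def JoinInLife (W : PEv → ℕ) : PGen γ → Prop
  | birth _ _ _ => True
  | renew G _ => G.JoinInLife W
  | join X Y s => X.JoinInLife W ∧ Y.JoinInLife W ∧ s < X.toGen.reach W ∧ s < Y.toGen.reach W

/-- **THE CANONICAL LABEL IS `Consistent`** under print's timing discipline and the two model-time side conditions.
[folklore] -/
theorem consistent_toGen (C : T4PrintedShapeBanking.Consts) (K : ℕ) (R : ℕ → ℕ) :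
    ∀ {P : PGen γ}, P.Adm K → P.RenewAtReach (dictW R C.n₁) → P.JoinInLife (dictW R C.n₁) →
      Consistent C K R P.toGen
  | birth j d z, hA, _, _ => by
      simp only [Adm] at hA
      simp only [toGen, Consistent]
      exact ⟨rfl, rfl, hA⟩
  | renew G h, hA, hR, hJ => by
      simp only [Adm] at hA; simp only [RenewAtReach] at hR; simp only [JoinInLife] at hJ
      simp only [toGen, Consistent]
      exact ⟨consistent_toGen C K R hA.1 hR.1 hJ, rfl, rfl, hR.2, hA.2.2⟩
  | join X Y s, hA, hR, hJ => by
      have hx := Adm.rootStep_le_lastStep hA.1; have hy := Adm.rootStep_le_lastStep hA.2.1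
      simp only [Adm] at hA; simp only [RenewAtReach] at hR; simp only [JoinInLife] at hJ
      simp only [toGen, Consistent, rootStep_toGen]
      exact ⟨consistent_toGen C K R hA.1 hR.1 hJ.1, consistent_toGen C K R hA.2.1 hR.2 hJ.2.1, rfl,
        hx.trans hA.2.2.1, hJ.2.2.1, hy.trans hA.2.2.2.1, hJ.2.2.2, hA.2.2.2.2⟩

/-- **THE CANONICAL LABEL IS WELL FORMED** under `TypeNodup` and the same side conditions. [folklore] -/
theorem wf_toGen {K : ℕ} (W : PEv → ℕ) :
    ∀ {P : PGen γ}, P.TypeNodup → P.Adm K → P.RenewAtReach W → P.JoinInLife W → P.toGen.WF W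
  | birth _ _ _, _, _, _, _ => trivial
  | renew G h, hT, hA, hR, hJ => by
      have hD := (distinct_toGen_iff (renew G h)).2 hT
      simp only [toGen, DistinctEv] at hD
      simp only [TypeNodup, evTypes, Multiset.nodup_cons] at hT
      have hx := Adm.rootStep_le_lastStep hA.1
      simp only [Adm] at hA; simp only [RenewAtReach] at hR; simp only [JoinInLife] at hJ
      simp only [toGen, Gen.WF, rootStep_toGen]
      exact ⟨wf_toGen W hT.2 hA.1 hR.1 hJ, hD.2, hx.trans hA.2.1, by omega⟩
  | join X Y s, hT, hA, hR, hJ => by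
      have hD := (distinct_toGen_iff (join X Y s)).2 hT
      simp only [toGen, DistinctEv] at hD
      simp only [TypeNodup, evTypes, Multiset.nodup_cons, Multiset.nodup_add] at hT
      have hx := Adm.rootStep_le_lastStep hA.1; have hy := Adm.rootStep_le_lastStep hA.2.1
      simp only [Adm] at hA; simp only [RenewAtReach] at hR; simp only [JoinInLife] at hJ
      simp only [toGen, Gen.WF, rootStep_toGen]
      exact ⟨wf_toGen W hT.2.1 hA.1 hR.1 hJ.1, wf_toGen W hT.2.2.1 hA.2.1 hR.2 hJ.2.1, hD.2.2.1, hD.2.2.2.1,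
        hD.2.2.2.2, by omega, by omega⟩

/-! ## §5 Class-monotonicity of the booked window and of the birth credit (H-GROUP arithmetic; convention withdrawn) -/

/-- the booked window of a birth is monotone in the class [folklore] -/
theorem dictW_birth_mono (R : ℕ → ℕ) (n₁ s : ℕ) {d D : ℕ} (h : d ≤ D) :
    dictW R n₁ (s, 0, d) ≤ dictW R n₁ (s, 0, D) := by
  simp only [dictW_birth, fatWait]
  have := Nat.log_mono_right (b := 2) h
  omega

/-- the birth credit is monotone in the class (`a ≥ 0`, `p₀(g) ≥ 0`) [folklore] -/
theorem credit_birth_mono (C : T4PrintedShapeBanking.Consts) (g : ℕ → ℝ) (ha : 0 ≤ C.a) (s : ℕ) {d D : ℕ} (h : d ≤ D) :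
    credit C g (s, 0, d) ≤ credit C g (s, 0, D) := by
  rw [credit_kind0 (C := C) (g := g) (show PEv.kind (s, 0, d) = 0 from rfl),
    credit_kind0 (C := C) (g := g) (show PEv.kind (s, 0, D) = 0 from rfl)]
  simp only [PEv.step_mk, PEv.fat_mk]
  have hd' : (d : ℝ) ≤ D := by exact_mod_cast h
  have hd : (d : ℝ) + 1 ≤ D + 1 := by linarith
  have hp : 0 ≤ C.a * p0Profile C.A₀ C.p₀ (g s) ^ 2 := mul_nonneg ha (sq_nonneg _)
  have := mul_le_mul_of_nonneg_left hd hp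
  linarith

/-! ## §6 Sanity, decided -/

namespace Sanity

/-- two unit regions born at step `0` at different cells, joined at step `3` — the commonest composite structure
[folklore] -/
def twin : PGen ℕ := join (birth 0 1 5) (birth 0 1 9) 3

/-- … has a repeated event type [folklore] -/
theorem twin_not_typeNodup : ¬ twin.TypeNodup := by decide

/-- … hence NO well-formed canonical label, whatever the window table (F-ne7bp1g22-1(d), decided instance) [folklore] -/
theorem twin_not_wf (W : PEv → ℕ) : ¬ twin.toGen.WF W := not_wf_toGen twin_not_typeNodup W

/-- a unit region born at `0` joined at step `3` by a class-`2` region born at `2`, the whole renewed at readiness `6`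
[folklore] -/
def hist : PGen ℕ := renew (join (birth 0 1 5) (birth 2 2 9) 3) 6

/-- … has pairwise distinct event types [folklore] -/
theorem hist_typeNodup : hist.TypeNodup := by decide

/-- … obeys the timing discipline up to `K = 7` [folklore] -/
theorem hist_adm : hist.Adm 7 := by simp [hist, Adm, lastStep]

/-- its root step and root cell are those of the first-born constituent [folklore] -/
example : hist.rootStep = 0 ∧ hist.rootCell = 5 ∧ hist.regions = 2 := by decide

/-- its canonical label [folklore] -/
example : hist.toGen =
    Gen.renew (Gen.merge (Gen.born (0, 0, 1) 0) (Gen.born (2, 0, 2) 2) (3, 2, 0)) (7, 1, 0) 6 := rfl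

end Sanity

end PGen

end Summit.QuantumFields.BalabanUV.T4Continuum.HistoryAdmissible
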